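import Mathlib
import Summits.ResolutionOfSingularities.ResolutionOfSingularities.Theorems.RadicialJungCleanModelsCleanLU3CompositeRamified
import Literature.AlgebraicGeometry.Resolution.RsopMonomialIdeals
import Summits.ResolutionOfSingularities.ResolutionOfSingularities.Theorems.RadicialJungCleanModelsCleanLU3CompositeLiftPrelims
import HarnessLib

/-!
# Route `RadicialJung`, crux `CleanModels` (stmt-15917), stub `stub_cleanLU3DefectNonDiscrete`, sub-line (C-div): the LIFT LEMMA —
# iterated curve blow-ups inside the divisor making `τ / ∏ fᵢ^{eᵢ}` a regular parameter

Line `Sketch` rev 24 of crux stmt-ResolutionOfSingularities-15917; lead `res-B-lead-1` g4 (workfile `Lines/Sketch_Cdiv_assembly.lean` v2,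
piece LIFT LEMMA, second part; memo `Lines/Sketch-memo-Cdiv-lift.md` §2).  OURS; nothing here proves resolution in characteristic `p`.

`exists_model_div_list`: start from a finitely generated model `A₁ ⊇ A` along `O` with regular local ring `R₁`, a coarsening `O₁ ≥ O` with
`O₁ ⊆ locAtCentre R₁ O₁`, residue image `im R₁ = S` (a local ring dominated by `Ō`), and a PRIME `τ ∈ R₁` with `v₁ τ < 1` (so `τ` generates the
kernel of the residue map, ✓ `residue_eq_zero_iff_dvd`).  For every finite list of triples `(f, g, e)` with `f, g ∈ R₁`, `v₁ f = 1`, and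
`(res f, res g)` generating the maximal ideal of `S`, successive blow-ups of the regular curves `(τ, f)` (✓ `exists_model_rsop_div_pow_im`, with
`𝔪 = (τ, f, g)` by ✓ `maximalIdeal_eq_span_of_residue`) produce a finitely generated model `A₂ ⊇ A` with regular local ring `R₂ ⊇ R₁`, the SAME
residue image `S`, in which `τ / ∏ f^e` is again a prime of `v₁`-value `< 1`.
-/

noncomputable section

set_option linter.dupNamespace false -- mandated namespace of this single-conjunct summit

open IsLocalRing
open Literature.AlgebraicGeometry.Resolution

namespace Summit.ResolutionOfSingularities.ResolutionOfSingularities.Theorems.RadicialJung.CleanModels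

variable {K : Type} [Field K] {k : Type} [Field k] [Algebra k K]

/-- A member of a three-element regular system of parameters of a regular local ring of dimension `3` is prime. [folklore] -/
theorem prime_of_rsop_three (R : Subring K) [IsRegularLocalRing R] (hdim : ringKrullDim R = 3) (t₁ t₂ t₃ : R)
    (hmax : maximalIdeal R = Ideal.span {t₁, t₂, t₃}) : Prime t₁ := by
  classical
  have hd3 : (maximalIdeal R).spanFinrank = 3 := spanFinrank_eq_three_of_dim R hdim
  let x : Fin 3 → R := ![t₁, t₂, t₃]
  have hx : Ideal.span (Set.range x) = maximalIdeal R := by rw [range_vec3]; exact hmax.symm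
  exact (isRsopPart_comp_of_rsop hd3 x hx id Function.injective_id).prime 0

/-- **Iterated curve blow-ups inside the divisor.**  See the module docstring. [folklore] -/
theorem exists_model_div_list (O O₁ : ValuationSubring K) (hOO₁ : O ≤ O₁) (A : Subalgebra k K) (hAfg : A.FG) [IsFractionRing A K]
    (hzd : ∀ (T : Subring K) (hT : T ≤ O.toSubring), A.toSubring ≤ T → (subringCentre T O hT).IsMaximal)
    (hdimA : ringKrullDim A = 3)
    (S : Subring (ResidueField O₁)) [IsLocalRing S] (hSdom : SubringDominates S (residueValuationSubring O O₁ hOO₁).toSubring) :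
    ∀ (L : List (K × K × ℕ)) (A₁ : Subalgebra k K) (_ : A ≤ A₁) (_ : A₁.FG) (hA₁O : A₁.toSubring ≤ O.toSubring)
      (_ : IsRegularLocalRing (locAtCentre A₁.toSubring O))
      (_ : ((locAtCentre A₁.toSubring O).comap O₁.toSubring.subtype).map (residue O₁) = S)
      (_ : O₁.toSubring ≤ locAtCentre (locAtCentre A₁.toSubring O) O₁)
      (τ : K) (hτ : τ ∈ locAtCentre A₁.toSubring O) (_ : Prime (⟨τ, hτ⟩ : locAtCentre A₁.toSubring O))
      (_ : O₁.valuation τ < 1)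
      (_ : ∀ t ∈ L, ∃ (h₁ : t.1 ∈ locAtCentre A₁.toSubring O) (h₂ : t.2.1 ∈ locAtCentre A₁.toSubring O),
        O₁.valuation t.1 = 1 ∧
        ∃ (hs₁ : residue O₁ ⟨t.1, hOO₁ (locAtCentre_le hA₁O h₁)⟩ ∈ S)
          (hs₂ : residue O₁ ⟨t.2.1, hOO₁ (locAtCentre_le hA₁O h₂)⟩ ∈ S),
          maximalIdeal S = Ideal.span {⟨_, hs₁⟩, ⟨_, hs₂⟩}),
      ∃ (A₂ : Subalgebra k K), A ≤ A₂ ∧ A₂.FG ∧ ∃ (_ : A₂.toSubring ≤ O.toSubring),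
        IsRegularLocalRing (locAtCentre A₂.toSubring O) ∧ locAtCentre A₁.toSubring O ≤ locAtCentre A₂.toSubring O ∧
        ((locAtCentre A₂.toSubring O).comap O₁.toSubring.subtype).map (residue O₁) = S ∧
        ∃ (hτ' : τ / (L.map fun t => t.1 ^ t.2.2).prod ∈ locAtCentre A₂.toSubring O),
          Prime (⟨_, hτ'⟩ : locAtCentre A₂.toSubring O) := by
  intro L
  induction L with
  | nil =>
    intro A₁ hAA₁ hA₁fg hA₁O hreg₁ himm _ τ hτ hprime _ _
    refine ⟨A₁, hAA₁, hA₁fg, hA₁O, hreg₁, le_rfl, himm, ?_, ?_⟩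
    · rw [List.map_nil, List.prod_nil, div_one]; exact hτ
    · have : (⟨τ / (([] : List (K × K × ℕ)).map fun t => t.1 ^ t.2.2).prod, by
          rw [List.map_nil, List.prod_nil, div_one]; exact hτ⟩ : locAtCentre A₁.toSubring O) = ⟨τ, hτ⟩ := by
        apply Subtype.ext
        change τ / (([] : List (K × K × ℕ)).map fun t => t.1 ^ t.2.2).prod = τ
        rw [List.map_nil, List.prod_nil, div_one]
      rw [this]; exact hprime
  | cons hd L ih =>
    intro A₁ hAA₁ hA₁fg hA₁O hreg₁ himm hloc τ hτ hprime hvτ hL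
    obtain ⟨f, g, e⟩ := hd
    set R₁ : Subring K := locAtCentre A₁.toSubring O with hR₁
    haveI := hreg₁
    have hR₁O : R₁ ≤ O.toSubring := locAtCentre_le hA₁O
    have hR₁O₁ : R₁ ≤ O₁.toSubring := fun z hz => hOO₁ (hR₁O hz)
    have hRm : ∀ r : R₁, r ∈ maximalIdeal R₁ ↔ O.valuation (r : K) < 1 := fun r => mem_maximalIdeal_locAtCentre_iff hA₁O r
    -- the data of the head
    obtain ⟨hf, hg, hvf, hsf, hsg, hS⟩ := hL (f, g, e) (List.mem_cons_self ..)
    change f ∈ R₁ at hf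
    change g ∈ R₁ at hg
    change O₁.valuation f = 1 at hvf
    -- `𝔪(R₁) = (τ, f, g)`
    have hker : ∀ r : R₁, residue O₁ ⟨(r : K), hOO₁ (hR₁O r.2)⟩ = 0 → (⟨τ, hτ⟩ : R₁) ∣ r := fun r hr =>
      (residue_eq_zero_iff_dvd O₁ R₁ hR₁O₁ hloc ⟨τ, hτ⟩ hprime hvτ r).mp hr
    have hmax : maximalIdeal R₁ = Ideal.span {(⟨τ, hτ⟩ : R₁), ⟨f, hf⟩, ⟨g, hg⟩} :=
      maximalIdeal_eq_span_of_residue O O₁ hOO₁ R₁ hR₁O hRm ⟨τ, hτ⟩ hvτ hker S hSdom himm ⟨f, hf⟩ ⟨g, hg⟩ hsf hsg hS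
    -- `τ` is infinitely deeper than the `O₁`-unit `f`
    have hdeep : ∀ m : ℕ, O.valuation τ < O.valuation (f ^ (m + 1)) := fun m =>
      valuation_lt_of_le_of_valuation_lt O O₁ hOO₁ (by rw [map_pow, hvf, one_pow]; exact hvτ)
    -- blow up the curve `(τ, f)` `e` times
    obtain ⟨A₂, hAA₂, hA₂fg, hA₂O, hreg₂, h12, him₂, h₁, h₂, h₃, hmax₂⟩ :=
      exists_model_rsop_div_pow_im O O₁ hOO₁ A hAfg hzd hdimA e A₁ hAA₁ hA₁fg hA₁O hreg₁ τ f g hτ hf hg hmax hdeep hvτ hvf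
    haveI := hreg₂
    have hdim₂ : ringKrullDim (locAtCentre A₂.toSubring O) = 3 := by
      rw [ringKrullDim_locAtCentre_eq_of_isMaximal A₂ hA₂fg O hA₂O (hzd _ hA₂O (fun z hz => hAA₂ hz)),
        ringKrullDim_eq_of_fg_of_le hAfg hA₂fg hAA₂, hdimA]
    have hprime₂ : Prime (⟨τ / f ^ e, h₁⟩ : locAtCentre A₂.toSubring O) :=
      prime_of_rsop_three _ hdim₂ _ _ _ hmax₂
    have hvτ₂ : O₁.valuation (τ / f ^ e) < 1 := by
      rw [map_div₀, map_pow, hvf, one_pow, div_one]; exact hvτ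
    have hloc₂ : O₁.toSubring ≤ locAtCentre (locAtCentre A₂.toSubring O) O₁ :=
      hloc.trans (locAtCentre_mono O₁ h12)
    have him₂' : ((locAtCentre A₂.toSubring O).comap O₁.toSubring.subtype).map (residue O₁) = S := him₂.trans himm
    -- the tail data, transported to `A₂`
    have hL₂ : ∀ t ∈ L, ∃ (h₁ : t.1 ∈ locAtCentre A₂.toSubring O) (h₂ : t.2.1 ∈ locAtCentre A₂.toSubring O),
        O₁.valuation t.1 = 1 ∧
        ∃ (hs₁ : residue O₁ ⟨t.1, hOO₁ (locAtCentre_le hA₂O h₁)⟩ ∈ S)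
          (hs₂ : residue O₁ ⟨t.2.1, hOO₁ (locAtCentre_le hA₂O h₂)⟩ ∈ S),
          maximalIdeal S = Ideal.span {⟨_, hs₁⟩, ⟨_, hs₂⟩} := by
      intro t ht
      obtain ⟨k₁, k₂, hv, hs₁, hs₂, hS'⟩ := hL t (List.mem_cons_of_mem _ ht)
      exact ⟨h12 k₁, h12 k₂, hv, hs₁, hs₂, hS'⟩
    obtain ⟨A₃, hAA₃, hA₃fg, hA₃O, hreg₃, h23, him₃, hτ₃, hprime₃⟩ :=
      ih A₂ hAA₂ hA₂fg hA₂O hreg₂ him₂' hloc₂ (τ / f ^ e) h₁ hprime₂ hvτ₂ hL₂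
    have heq : τ / f ^ e / (L.map fun t => t.1 ^ t.2.2).prod = τ / (((f, g, e) :: L).map fun t => t.1 ^ t.2.2).prod := by
      rw [List.map_cons, List.prod_cons, div_div]
    refine ⟨A₃, hAA₃, hA₃fg, hA₃O, hreg₃, h12.trans h23, him₃, heq ▸ hτ₃, ?_⟩
    have : (⟨τ / (((f, g, e) :: L).map fun t => t.1 ^ t.2.2).prod, heq ▸ hτ₃⟩ : locAtCentre A₃.toSubring O) =
        ⟨τ / f ^ e / (L.map fun t => t.1 ^ t.2.2).prod, hτ₃⟩ := Subtype.ext heq.symm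
    rw [this]; exact hprime₃

end Summit.ResolutionOfSingularities.ResolutionOfSingularities.Theorems.RadicialJung.CleanModels

end
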